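import Literature.NumberTheory.QuadraticFields.RealQuadraticRegulator
import Literature.NumberTheory.QuadraticFields.QuadraticDedekindZeta
import Literature.NumberTheory.LFunctions.ImaginaryQuadraticResidueBound
import Literature.NumberTheory.LFunctions.UniformClassGroupPNTGeneralDegree
import HarnessLib

/-!
# `R_K ≥ log((1+√5)/2)` for real quadratic fields, and `κ_K ≥ Q⁻¹` for EVERY quadratic field

Topic `NumberTheory/QuadraticFields`, namespace `Literature.NumberTheory.QuadraticFields.Quadratic`.
Theorem-only file.

* `log_goldenRatio_le_regulator` — the SHARP uniform lower bound for the regulator of a real quadratic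
  field: `R_K ≥ log((1+√5)/2) = R_{ℚ(√5)}` (the tree's `regulator_eq_log_fundUnit'`, `R_K = log ε_{d_K}`, and
  `ε_D = (G + B√D)/2` with `G, B ≥ 1`, `QuadIrr.exists_fundUnit_eq`; `d_K ≥ 5`).
* `dedekindZeta_residue_ge_of_discr_pos` — `κ_K = 4 R_K h_K /(2√d_K) ≥ 2 log((1+√5)/2)/√d_K` for a real
  quadratic field (class number formula = Mathlib's definition of `dedekindZeta_residue`; `r₁ = 2`, `r₂ = 0`,
  `w_K = 2`).
* `condQn_rpow_neg_one_le_residue_of_finrank_eq_two` — **`κ_K ≥ Q⁻¹`, `Q = condQn K = 4|d_K|`, for EVERY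
  quadratic field** (real case above; imaginary case = the tree's `condQ_inv_le_dedekindZeta_residue`):
  the EXPLICIT exponent `A = 1` at degree `2` of the residue hypothesis `condQn K ^ (−A) ≤ κ_K` of the
  log-free zero-density / class-PNT chain (the all-degree statement with an inexplicit `A(n)` is
  `ThornerZaman.exists_condQn_rpow_neg_le_residue`).

## References
* O. Bordellès, *Arithmetic Tales*, §7.5.12.2 ("the smallest regulator of a totally real field is log Φ, the
  regulator of ℚ(√5)"). [folklore]
* M. J. Jacobson, H. C. Williams, *Solving the Pell Equation*, §4.3, §5.3. [JacobsonWilliams2008]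
-/

noncomputable section

open Module NumberField NumberField.InfinitePlace NumberField.Units

namespace Literature.NumberTheory.QuadraticFields.Quadratic

open Literature.NumberTheory.LFunctions.NumberField

variable {K : Type*} [Field K] [NumberField K]

/-- A positive field discriminant of a quadratic field is `≥ 5` (`d ≡ 0, 1 (mod 4)`, not a square,
so `d ∉ {1, 2, 3, 4}`). [folklore] -/
theorem five_le_discr_toNat (h2 : finrank ℚ K = 2) (hd : 0 < NumberField.discr K) :
    5 ≤ (NumberField.discr K).toNat := by
  have hsq := not_isSquare_discr_toNat h2 hd
  have h4 := discr_toNat_mod_four h2 hd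
  set D := (NumberField.discr K).toNat with hD
  by_contra hlt
  rw [not_le] at hlt
  interval_cases D
  · omega
  · exact hsq ⟨1, by norm_num⟩
  · omega
  · omega
  · exact hsq ⟨2, by norm_num⟩

/-- `ε_D ≥ (1 + √5)/2` for the fundamental unit of the principal cycle of a discriminant `D ≥ 5`
(`ε_D = (G + B√D)/2` with `G, B ≥ 1`). [cite: JacobsonWilliams2008, §4.3 with §5.3 (5.33)] -/
theorem goldenRatio_le_fundUnit {D : ℕ} (hD : ¬ IsSquare D) (hD4 : D % 4 = 0 ∨ D % 4 = 1) (h5 : 5 ≤ D) :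
    (1 + Real.sqrt 5) / 2 ≤ QuadIrr.fundUnit D := by
  obtain ⟨G, B, hG, hB, -, hε, -⟩ := QuadIrr.exists_fundUnit_eq hD hD4
  rw [hε]
  have hG' : (1 : ℝ) ≤ G := by exact_mod_cast hG
  have hB' : (1 : ℝ) ≤ B := by exact_mod_cast hB
  have h5' : Real.sqrt 5 ≤ Real.sqrt D := Real.sqrt_le_sqrt (by exact_mod_cast h5)
  have hs0 : 0 ≤ Real.sqrt D := Real.sqrt_nonneg _
  nlinarith

/-- **`R_K ≥ log((1 + √5)/2)` for every real quadratic field** — the sharp uniform lower bound (equality for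
`ℚ(√5)`). [folklore] -/
theorem log_goldenRatio_le_regulator (h2 : finrank ℚ K = 2) (hd : 0 < NumberField.discr K) :
    Real.log ((1 + Real.sqrt 5) / 2) ≤ regulator K := by
  rw [regulator_eq_log_fundUnit' h2 hd]
  exact Real.log_le_log (by positivity)
    (goldenRatio_le_fundUnit (not_isSquare_discr_toNat h2 hd) (discr_toNat_mod_four h2 hd)
      (five_le_discr_toNat h2 hd))

/-- `log((1+√5)/2) ≥ 3/8` (from `1 − 1/x ≤ log x` at `x = (1+√5)/2`, `1/x = x − 1`). [folklore] -/
theorem three_eighths_le_log_goldenRatio : (3 : ℝ) / 8 ≤ Real.log ((1 + Real.sqrt 5) / 2) := by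
  have h5 : Real.sqrt 5 ^ 2 = 5 := Real.sq_sqrt (by norm_num)
  have hs0 : 0 ≤ Real.sqrt 5 := Real.sqrt_nonneg 5
  have hs' : Real.sqrt 5 ≤ 2.25 := by nlinarith
  have hpos : 0 < (1 + Real.sqrt 5) / 2 := by positivity
  have h := Real.one_sub_inv_le_log_of_pos hpos
  have hinv : ((1 + Real.sqrt 5) / 2)⁻¹ = (Real.sqrt 5 - 1) / 2 := by
    rw [inv_eq_iff_eq_inv, inv_div, eq_div_iff (by nlinarith : Real.sqrt 5 - 1 ≠ 0)]
    nlinarith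
  rw [hinv] at h
  linarith

/-- **`κ_K ≥ 2 log((1+√5)/2)/√d_K` for a real quadratic field** (`κ_K = 2² R_K h_K/(2 √d_K)`, `h_K ≥ 1`,
`R_K ≥ log((1+√5)/2)`). [folklore] -/
theorem dedekindZeta_residue_ge_of_discr_pos (h2 : finrank ℚ K = 2) (hd : 0 < NumberField.discr K) :
    2 * Real.log ((1 + Real.sqrt 5) / 2) / Real.sqrt |(NumberField.discr K : ℝ)| ≤
      dedekindZeta_residue K := by
  obtain ⟨hr₁, hr₂⟩ := nrRealPlaces_eq_two_and_nrComplexPlaces_eq_zero h2 hd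
  have hw := torsionOrder_eq_two_of_discr_pos h2 hd
  have hR := log_goldenRatio_le_regulator h2 hd
  have hh : (1 : ℝ) ≤ classNumber K := by exact_mod_cast classNumber_pos K
  have hdR : 0 < Real.sqrt |(NumberField.discr K : ℝ)| :=
    Real.sqrt_pos.2 (abs_pos.2 (by exact_mod_cast NumberField.discr_ne_zero K))
  have hlog : 0 < Real.log ((1 + Real.sqrt 5) / 2) := by
    have := three_eighths_le_log_goldenRatio; linarith
  rw [NumberField.dedekindZeta_residue_def, hr₁, hr₂, hw]
  rw [div_le_div_iff₀ hdR (by positivity)]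
  push_cast
  have : Real.log ((1 + Real.sqrt 5) / 2) * 1 ≤ regulator K * (classNumber K : ℝ) :=
    mul_le_mul hR hh zero_le_one (le_trans hlog.le hR)
  nlinarith

/-- **`Q⁻¹ ≤ κ_K` for a real quadratic field**, `Q = condQn K = 4 d_K`
(`2 log((1+√5)/2) ≥ 3/4`, `√d ≤ d`). [folklore] -/
theorem condQn_rpow_neg_one_le_residue_of_discr_pos (h2 : finrank ℚ K = 2) (hd : 0 < NumberField.discr K) :
    ThornerZaman.condQn K ^ (-(1 : ℝ)) ≤ dedekindZeta_residue K := by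
  refine le_trans ?_ (dedekindZeta_residue_ge_of_discr_pos h2 hd)
  set d : ℝ := |(NumberField.discr K : ℝ)| with hdd
  have hd1 : (1 : ℝ) ≤ d := by
    rw [hdd, ← Int.cast_abs]; exact_mod_cast Int.one_le_abs (NumberField.discr_ne_zero K)
  have hQ : ThornerZaman.condQn K = d * 4 := by
    rw [ThornerZaman.condQn, h2, hdd]; norm_num
  have hsqrt : Real.sqrt d ≤ d := by
    rw [Real.sqrt_le_left (by linarith)]; nlinarith
  have hsqrt0 : 0 < Real.sqrt d := Real.sqrt_pos.2 (by linarith)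
  have hlog := three_eighths_le_log_goldenRatio
  rw [hQ, Real.rpow_neg (by positivity), Real.rpow_one, le_div_iff₀ hsqrt0]
  calc (d * 4)⁻¹ * Real.sqrt d ≤ (d * 4)⁻¹ * d := by gcongr
    _ = 1 / 4 := by field_simp
    _ ≤ 2 * Real.log ((1 + Real.sqrt 5) / 2) := by linarith

/-- **`Q⁻¹ ≤ κ_K` for EVERY quadratic field**, `Q = condQn K = 4|d_K|`: the explicit exponent `A = 1` at
degree `2` of the residue hypothesis of the log-free density / class-PNT chain (real case above; imaginary case the
tree's `condQ_inv_le_dedekindZeta_residue`). [folklore] -/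
theorem condQn_rpow_neg_one_le_residue_of_finrank_eq_two (h2 : finrank ℚ K = 2) :
    ThornerZaman.condQn K ^ (-(1 : ℝ)) ≤ dedekindZeta_residue K := by
  rcases lt_or_gt_of_ne (NumberField.discr_ne_zero K) with hd | hd
  · rw [ThornerZaman.condQn_eq_condQ K h2, Real.rpow_neg (le_of_lt (lt_trans zero_lt_one (ThornerZaman.one_lt_condQ K))),
      Real.rpow_one]
    exact condQ_inv_le_dedekindZeta_residue h2 hd
  · exact condQn_rpow_neg_one_le_residue_of_discr_pos h2 hd

end Literature.NumberTheory.QuadraticFields.Quadratic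

end
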